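import Literature.MathematicalPhysics.KineticTheory.HardSphereWindowPressureStatic
import Literature.MathematicalPhysics.KineticTheory.HardSphereDisplacementPathLength
import Literature.Probability.Moments.GaussianNormExpMoment
import Summits.AtomisticToContinuum.HydrodynamicLimit.Theorems.AntiMazurCoboundariesInfluenceLocalityTrueCapsExistPrelimA
import Summits.AtomisticToContinuum.HydrodynamicLimit.Theorems.JParityClosureOddContactSymmetryGibbsInvariance

/-!
# One-site Gaussian bound for the within-lag shot-noise pressure

Route `AntiMazurCoboundaries` of `AtomisticToContinuum/HydrodynamicLimit`, crux stmt-AtomisticToContinuum-14135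
(`CorrectorPressureDecay`), line `almost-invariant-duality`, lead-held layer-2 input h₂ = within-lag SHOT-NOISE
PRESSURE (hypothesis `h₂` of `TransferSkeleton.correctorPressureDecay_of_inputs`); registered sub-goal `snp_oneSite`.

After Jensen in time, flow invariance and the velocity product formula
(`lintegral_exp_windowAvg_sum_localGibbsLaw_const_le`), the shot-noise pressure of the path-length functional
reduces to the ONE-SITE Gaussian exponential moment
`∫ exp((b/R) · max 0 (2‖v‖ − R)) N(u₀, θ id)(dv)`, which must be `≤ e^ψ` for every prescribed `ψ > 0` once
the speed threshold `R` is large (`snp_oneSite`).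

Proof. For `R ≥ 1`, `b ≥ 0` and every `v`, pointwise
`exp((b/R) · max 0 (2‖v‖ − R)) ≤ 1 + e^{−R/2} · exp((2b+1)‖v‖)` (`snp_oneSite_pointwise`: if `2‖v‖ ≤ R` the
left side is `1`; otherwise the exponent is `≤ 2b‖v‖ ≤ 2b‖v‖ + (‖v‖ − R/2)`).  Integrating,
`∫⁻ ≤ 1 + e^{−R/2} · m` with `m = ∫ exp((2b+1)‖v‖) dN(u₀, θ id) < ∞` — ALL exponential moments of the norm are
finite under a Gaussian measure (`Literature.Probability.Moments.integrable_exp_mul_norm_of_isGaussian`, Fernique;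
`gaussMeasure u₀ θ` is Gaussian, `isGaussian_gaussMeasure`).  Finally `1 + e^{−R/2} m ≤ e^ψ` as soon as
`R ≥ 2m/(e^ψ − 1)` (`e^{R/2} ≥ R/2 + 1`), so `R₀ = max 1 (2m/(e^ψ − 1))` works.
-/

noncomputable section

open MeasureTheory Set Filter Topology
open scoped ENNReal Classical

namespace Summit.AtomisticToContinuum.HydrodynamicLimit.Theorems.ShotNoisePressure

open Literature.Analysis.FluidPDE
open Literature.MathematicalPhysics.KineticTheory (T3 V3 hsDiameter localGibbsLaw gaussMeasure)

/-- **Pointwise bound.** For `b ≥ 0`, `R ≥ 1` and `x ≥ 0`: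
`exp((b/R) · max 0 (2x − R)) ≤ 1 + e^{−R/2} · e^{(2b+1)x}` (if `2x ≤ R` the left side is `1`; otherwise
`(b/R)(2x − R) ≤ 2bx/R ≤ 2bx < 2bx + (x − R/2)`). [folklore] -/
theorem snp_oneSite_pointwise {b R : ℝ} (hb : 0 ≤ b) (hR : 1 ≤ R) (x : ℝ) (hx : 0 ≤ x) :
    Real.exp (b / R * max 0 (2 * x - R)) ≤
      1 + Real.exp (-(R / 2)) * Real.exp ((2 * b + 1) * x) := by
  have hpos : 0 ≤ Real.exp (-(R / 2)) * Real.exp ((2 * b + 1) * x) := by positivity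
  rcases le_or_gt (2 * x - R) 0 with h | h
  · rw [max_eq_left h, mul_zero, Real.exp_zero]
    linarith
  · rw [max_eq_right h.le, ← Real.exp_add]
    have hR0 : 0 < R := by linarith
    have h1 : b / R * (2 * x - R) ≤ 2 * b * x := by
      rw [div_mul_eq_mul_div, div_le_iff₀ hR0]
      nlinarith [mul_nonneg hb hx, mul_nonneg (mul_nonneg hb hx) (sub_nonneg.2 hR),
        mul_nonneg hb hR0.le]
    have h2 : b / R * (2 * x - R) ≤ -(R / 2) + (2 * b + 1) * x := by linarith
    calc Real.exp (b / R * (2 * x - R))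
        ≤ Real.exp (-(R / 2) + (2 * b + 1) * x) := Real.exp_le_exp.2 h2
      _ ≤ 1 + Real.exp (-(R / 2) + (2 * b + 1) * x) := by linarith

/-- **Elementary threshold.** If `0 < ψ` and `max 1 (2m/(e^ψ − 1)) ≤ R`, then `1 + e^{−R/2} m ≤ e^ψ`
(from `e^{R/2} ≥ R/2 + 1`). [folklore] -/
theorem snp_oneSite_threshold {m ψ R : ℝ} (hψ : 0 < ψ) (hR : max 1 (2 * m / (Real.exp ψ - 1)) ≤ R) :
    1 + Real.exp (-(R / 2)) * m ≤ Real.exp ψ := by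
  have hε : 0 < Real.exp ψ - 1 := by linarith [Real.add_one_le_exp ψ]
  have hR2 : 2 * m / (Real.exp ψ - 1) ≤ R := le_trans (le_max_right _ _) hR
  have h2m : 2 * m ≤ R * (Real.exp ψ - 1) := (div_le_iff₀ hε).1 hR2
  have hexp : R / 2 + 1 ≤ Real.exp (R / 2) := Real.add_one_le_exp _
  have h1 : m ≤ Real.exp (R / 2) * (Real.exp ψ - 1) := by
    nlinarith [mul_le_mul_of_nonneg_right hexp hε.le]
  have hkey : Real.exp (-(R / 2)) * m ≤ Real.exp ψ - 1 :=
    calc Real.exp (-(R / 2)) * m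
        ≤ Real.exp (-(R / 2)) * (Real.exp (R / 2) * (Real.exp ψ - 1)) :=
          mul_le_mul_of_nonneg_left h1 (Real.exp_pos _).le
      _ = Real.exp ψ - 1 := by
          rw [← mul_assoc, ← Real.exp_add, neg_add_cancel, Real.exp_zero, one_mul]
  linarith

/-- **One-site bound for a Gaussian law on `ℝ³`.** For a Gaussian measure `μ` on `ℝ³`, `b ≥ 0` and `ψ > 0`
there is `R₀ ≥ 1` with `∫⁻ exp((b/R) · max 0 (2‖v‖ − R)) dμ ≤ e^ψ` for all `R ≥ R₀` (pointwise bound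
`snp_oneSite_pointwise`, finiteness of `∫ exp((2b+1)‖v‖) dμ` by Fernique, threshold
`snp_oneSite_threshold`). [folklore] -/
theorem snp_oneSite_of_isGaussian (μ : Measure V3) [ProbabilityTheory.IsGaussian μ] {b ψ : ℝ}
    (hb : 0 ≤ b) (hψ : 0 < ψ) :
    ∃ R₀ : ℝ, 1 ≤ R₀ ∧ ∀ R : ℝ, R₀ ≤ R →
      ∫⁻ v, ENNReal.ofReal (Real.exp (b / R * max 0 (2 * ‖v‖ - R))) ∂μ ≤
        ENNReal.ofReal (Real.exp ψ) := by
  have hint : Integrable (fun v : V3 => Real.exp ((2 * b + 1) * ‖v‖)) μ :=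
    Literature.Probability.Moments.integrable_exp_mul_norm_of_isGaussian μ (2 * b + 1)
  have hM : ∫⁻ v, ENNReal.ofReal (Real.exp ((2 * b + 1) * ‖v‖)) ∂μ =
      ENNReal.ofReal (∫ v, Real.exp ((2 * b + 1) * ‖v‖) ∂μ) :=
    (ofReal_integral_eq_lintegral_ofReal hint (ae_of_all _ fun v => (Real.exp_pos _).le)).symm
  refine ⟨max 1 (2 * (∫ v, Real.exp ((2 * b + 1) * ‖v‖) ∂μ) / (Real.exp ψ - 1)), le_max_left _ _,
    fun R hR => ?_⟩
  have hR1 : 1 ≤ R := le_trans (le_max_left _ _) hR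
  have hpt : ∀ v : V3, ENNReal.ofReal (Real.exp (b / R * max 0 (2 * ‖v‖ - R))) ≤
      1 + ENNReal.ofReal (Real.exp (-(R / 2))) * ENNReal.ofReal (Real.exp ((2 * b + 1) * ‖v‖)) := by
    intro v
    calc ENNReal.ofReal (Real.exp (b / R * max 0 (2 * ‖v‖ - R)))
        ≤ ENNReal.ofReal (1 + Real.exp (-(R / 2)) * Real.exp ((2 * b + 1) * ‖v‖)) :=
          ENNReal.ofReal_le_ofReal (snp_oneSite_pointwise hb hR1 ‖v‖ (norm_nonneg v))
      _ = 1 + ENNReal.ofReal (Real.exp (-(R / 2))) * ENNReal.ofReal (Real.exp ((2 * b + 1) * ‖v‖)) := by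
          rw [ENNReal.ofReal_add zero_le_one (by positivity), ENNReal.ofReal_one,
            ENNReal.ofReal_mul (Real.exp_pos _).le]
  have hmeas : Measurable fun v : V3 => ENNReal.ofReal (Real.exp ((2 * b + 1) * ‖v‖)) :=
    (measurable_const.mul measurable_norm).exp.ennreal_ofReal
  calc ∫⁻ v, ENNReal.ofReal (Real.exp (b / R * max 0 (2 * ‖v‖ - R))) ∂μ
      ≤ ∫⁻ v, (1 + ENNReal.ofReal (Real.exp (-(R / 2))) *
          ENNReal.ofReal (Real.exp ((2 * b + 1) * ‖v‖))) ∂μ := lintegral_mono hpt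
    _ = 1 + ENNReal.ofReal (Real.exp (-(R / 2))) *
          ENNReal.ofReal (∫ v, Real.exp ((2 * b + 1) * ‖v‖) ∂μ) := by
        rw [lintegral_add_right _ (hmeas.const_mul _), lintegral_const, measure_univ, mul_one,
          lintegral_const_mul _ hmeas, hM]
    _ = ENNReal.ofReal (1 + Real.exp (-(R / 2)) * ∫ v, Real.exp ((2 * b + 1) * ‖v‖) ∂μ) := by
        rw [ENNReal.ofReal_add zero_le_one (by positivity), ENNReal.ofReal_one,
          ENNReal.ofReal_mul (Real.exp_pos _).le]
    _ ≤ ENNReal.ofReal (Real.exp ψ) := ENNReal.ofReal_le_ofReal (snp_oneSite_threshold hψ hR)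

/-- **One-site Gaussian bound for the shot-noise pressure** (registered sub-goal `snp_oneSite`): under the
Maxwellian `N(u₀, θ id)` and for `b ≥ 0`, `ψ > 0`, there is a speed threshold `R₀ ≥ 1` such that
`∫⁻ exp((b/R) · max 0 (2‖v‖ − R)) N(u₀, θ id)(dv) ≤ e^ψ` for all `R ≥ R₀` (`snp_oneSite_of_isGaussian` for the
Gaussian measure `gaussMeasure u₀ θ`; the hypothesis `0 < θ` of the registered signature is not needed — for
`θ ≤ 0` the law `gaussMeasure u₀ θ` is the Dirac mass at `u₀`, still Gaussian). [folklore] -/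
theorem snp_oneSite : ∀ (θ : ℝ) (hθ : 0 < θ) (u₀ : V3) (b ψ : ℝ) (hb : 0 ≤ b) (hψ : 0 < ψ),
    ∃ R₀ : ℝ, 1 ≤ R₀ ∧ ∀ R : ℝ, R₀ ≤ R →
      ∫⁻ v, ENNReal.ofReal (Real.exp (b / R * max 0 (2 * ‖v‖ - R))) ∂(gaussMeasure u₀ θ) ≤
        ENNReal.ofReal (Real.exp ψ) :=
  -- the positivity of `θ` (part of the registered signature) is not needed
  fun θ _ u₀ _ _ hb hψ => snp_oneSite_of_isGaussian (gaussMeasure u₀ θ) hb hψ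

end Summit.AtomisticToContinuum.HydrodynamicLimit.Theorems.ShotNoisePressure

end
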